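import Mathlib
import HarnessLib
import Summits.ValiantsHypothesis.ValiantsHypothesis.Theorems.EquivariantDialGrading
import Literature.Computability.AlgebraicComplexity.EquivariantDC
import Literature.Computability.AlgebraicComplexity.DetReprEquivalent
import Literature.Computability.AlgebraicComplexity.StandardFamiliesProofs

/-!
# Equivariant-dc dial, LAYERED notch (1/3): equivariant layered branching programs, the equivariant
# Nisan cut lemma («ideal width ≤ layer width») and the census cell `EqHardLayeredBiPerm`
# (decomp-valiant workshop, lens 1, generation 14) — KERNEL CERTIFICATE of a census cell; NOT a route

HONEST FRAMING.  Valiant's hypothesis (`VP ≠ VNP`, the tree's `ValiantsHypothesis`) is NOT proved here and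
nothing in this file is progress on it.  This is the first of three sorry-free SUPPORT files for the census
cell `A := EquivariantDialNode.EqHardBiPerm` («no polynomial-size family of affine determinantal
representations of `per_m` with EXACT lifts of the bi-permutation substitutions»; item
`stmt-ValiantsHypothesis-23702` is only SUPPORTED, not closed).  It types the cell's first concrete
lower-bound mechanism — the layer module of an equivariant layered program — and the new notch `A^lay`; the
sequels `EquivariantDialLayersValiant` / `…Lifts` prove `A ⟹ A^lay` (Valiant's construction carries exact
lifts), so the notch sits in the proved chain `S ⟹ W ⟹ A ⟹ A^lay ⟸ R^lay`.  No converse is claimed.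

## What is proved (kernel-checked, no `sorry`, no new axioms)

* §1 `LayeredABP σ k L w` — homogeneous layered algebraic branching programs in transfer-matrix form (`L`
  edge layers of LINEAR forms, uniform width `w`, constant source/sink weights; Nisan's model
  [Nisan1991Noncommutative, §2], [BlaserDorflerIkenmeyer2020, §4/Def 6.1]) with EXACT LAYERWISE LIFTS
  `LayeredABP.Lift` (`T t (γ·x) = R t · T t · (R (t+1))⁻¹`; the layered analogue of Landsberg–Ressayre's
  equivariant representations [LandsbergRessayre2017, Def 1.3] = the tree's `IsEquivariantDetRepr`);
  `HasLayeredWidthLE Γ f L w`; the **equivariant ideal width** `HasIdealWidthLE Γ f d r` / `idealWidth Γ f d`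
  («`f` is cut in degree `d` by `≤ r` forms spanning a `Γ`-stable space»).
* §2 **Equivariant Nisan cut lemma** `hasIdealWidthLE_of_layered`: a `Γ`-equivariant layered program of
  width `w` computing `f` gives `HasIdealWidthLE Γ f d w` at EVERY cut `d ≤ L` (`f = Σᵢ headᵢ · tailᵢ` with
  `w` head forms of degree `d`, on which an exact lift acts through the constant matrix `a · (R d)⁻¹`:
  `linSubst_head`); hence `idealWidth Γ f d ≤ w` (`idealWidth_le_of_hasLayeredWidthLE`).  This is the rank
  method of [Nisan1991Noncommutative, Thm 1] plus the one line that the cut space is a `Γ`-MODULE of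
  dimension `≤ w` — the typed «first lemma r_window(m,d) ≤ dim(layer d)» of the workshop record (bus 846).
* §3 Over `ℂ`, for a symmetry family `H m ≤ GL(m²)`: `PolyLayered H`, the notch
  `EqHardLayered H := ¬ PolyLayered H`, the leaf `IdealWidthSuperpoly H` («the `H_m`-equivariant ideal width
  of `per_m` is superpolynomial at some cuts `d ≤ m`»), the cell `EqHardLayeredBiPerm := EqHardLayered
  biPermSubst`; kernels `idealWidth_le_of_polyLayered`, `eqHardLayered_of_idealWidthSuperpoly`
  (`R^lay ⟹ A^lay`), `PolyLayered.anti` / `EqHardLayered.mono`.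

## Census tags (workshop grammar; evidence = the named theorems)

* `A^lay = EqHardLayeredBiPerm`: WEAKER · NEC (`S ⟹ A^lay`: `eqHardLayeredBiPerm_of_summit`, sequel 3/3) ·
  OPEN · UNDECIDED.  Not a costume for `S` or `A`: the converses `A^lay ⟹ A` (a homogenisation
  «equivariant det. representation ⟹ equivariant layered program» KEEPING the lifts; equivariance is not free
  — [LandsbergRessayre2017, §2], tree `LR17EquivariantRepresentations`) and `A ⟹ S` (symmetrisation) are open.
* `R^lay = IdealWidthSuperpoly biPermSubst`: INSTRUMENTABLE / ATTACKABLE leaf (dimension lower bounds for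
  `𝔖_m × 𝔖_m`-modules of degree-`d` forms cutting `per_m`); `R^lay ⟹ A^lay` proved.
* Barrier placement: the cut lemma is a RANK-TYPE measure, and commutative flattening-rank width bounds are
  capped (tree `RankMethodBarriers`, [BlaserDorflerIkenmeyer2020, §6]); the `Γ`-stability of the cut space
  is the added constraint, and whether it escapes the cap is what the leaf `R^lay` asks — no claim made here.

Uses `EquivariantDialNode` (cell `A`, `biPermSubst`, `EqHard`) and `linSubst` (`EquivariantDC`) by name;
restates nothing from `Literature`.  No `instance`, no `notation`.
-/

set_option linter.dupNamespace false

namespace Summit.ValiantsHypothesis.ValiantsHypothesis.Theorems.EquivariantDialLayers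

open MvPolynomial Matrix Literature.Computability.AlgebraicComplexity
open Summit.ValiantsHypothesis.ValiantsHypothesis.Theorems.EquivariantDialNode

noncomputable section

/-! ## §1 Homogeneous layered branching programs with exact layerwise lifts -/

/-- A **homogeneous layered algebraic branching program** with `L` layers of edges and every vertex
layer padded to exactly `w` vertices, in transfer-matrix form ([Nisan1991Noncommutative, §2];
[BlaserDorflerIkenmeyer2020, §4 and Def 6.1], cf. the tree's `BDI2020.HasNcABPWidthLE`): `T t` is the `w × w` matrix of LINEAR FORMS
labelling the edges from vertex layer `t` to vertex layer `t + 1`, and `u`, `v` are the (constant)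
source and sink weight vectors.  The program computes `uᵀ · T 0 · T 1 ⋯ T (L-1) · v` (`eval`). -/
structure LayeredABP (σ : Type*) (k : Type*) [CommRing k] (L w : ℕ) where
  /-- transition matrix of linear forms between vertex layers `t` and `t + 1` -/
  T : Fin L → Matrix (Fin w) (Fin w) (MvPolynomial σ k)
  /-- source weights -/
  u : Fin w → k
  /-- sink weights -/
  v : Fin w → k
  /-- every edge label is a linear form -/
  linear : ∀ t i j, (T t i j).IsHomogeneous 1

namespace LayeredABP

variable {σ : Type*} {k : Type*} [CommRing k] {L w : ℕ}

/-- The product `T 0 ⋯ T (L-1)` of all transition matrices. -/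
def prodT (P : LayeredABP σ k L w) : Matrix (Fin w) (Fin w) (MvPolynomial σ k) :=
  (List.ofFn P.T).prod

/-- The polynomial computed by the program: `uᵀ (T 0 ⋯ T (L-1)) v`. -/
def eval (P : LayeredABP σ k L w) : MvPolynomial σ k :=
  (fun i => C (P.u i)) ⬝ᵥ (P.prodT *ᵥ fun j => C (P.v j))

variable [Fintype σ] [DecidableEq σ]

/-- An **exact layerwise lift** of the substitution of variables `γ ∈ GL(σ)` to the program `P`:
invertible CONSTANT matrices `R 0, …, R L` on the vertex layers with `T t (γ·x) = R t · T t (x) · (R (t+1))⁻¹`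
for every edge layer, the source vector an eigenvector of `R 0` and the sink vector an eigenvector of `R L`.
(For programs with one source and one sink vertex the two eigen-conditions are automatic.)  This is the
layered analogue of Landsberg–Ressayre's exact lifts `A(γ·x) = g A(x) h⁻¹` (`IsEquivariantDetRepr`). -/
structure Lift (P : LayeredABP σ k L w) (γ : GL σ k) where
  /-- the lift on vertex layer `t` -/
  R : Fin (L + 1) → GL (Fin w) k
  /-- eigenvalue of the source vector -/
  a : kˣ
  /-- eigenvalue of the sink vector -/
  b : kˣ
  layer : ∀ t : Fin L, Matrix.linSubstEntries γ (P.T t) =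
    ((R t.castSucc : GL (Fin w) k) : Matrix (Fin w) (Fin w) k).map C * P.T t *
      (((R t.succ)⁻¹ : GL (Fin w) k) : Matrix (Fin w) (Fin w) k).map C
  src : P.u ᵥ* ((R 0 : GL (Fin w) k) : Matrix (Fin w) (Fin w) k) = (a : k) • P.u
  snk : ((R (Fin.last L) : GL (Fin w) k) : Matrix (Fin w) (Fin w) k) *ᵥ P.v = (b : k) • P.v

/-- The program is `Γ`-equivariant: every `γ ∈ Γ` admits an exact layerwise lift. -/
def IsEquivariant (Γ : Subgroup (GL σ k)) (P : LayeredABP σ k L w) : Prop :=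
  ∀ γ ∈ Γ, Nonempty (P.Lift γ)

end LayeredABP

section Width

variable {σ : Type*} {k : Type*} [CommRing k] [Fintype σ] [DecidableEq σ]

/-- `f` is computed by a `Γ`-equivariant homogeneous layered branching program with `L` edge layers and
width `w`. -/
def HasLayeredWidthLE (Γ : Subgroup (GL σ k)) (f : MvPolynomial σ k) (L w : ℕ) : Prop :=
  ∃ P : LayeredABP σ k L w, P.IsEquivariant Γ ∧ P.eval = f

/-- **Equivariant ideal width.**  `f` lies in the ideal generated by at most `r` FORMS OF DEGREE `d` whose
`k`-span is stable under every substitution `γ ∈ Γ` («`f` can be cut in degree `d` by a `Γ`-module of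
dimension `≤ r`»). -/
def HasIdealWidthLE (Γ : Subgroup (GL σ k)) (f : MvPolynomial σ k) (d r : ℕ) : Prop :=
  ∃ s : Finset (MvPolynomial σ k), s.card ≤ r ∧ (∀ p ∈ s, p.IsHomogeneous d) ∧
    (∀ γ ∈ Γ, ∀ p ∈ s, linSubst σ k (γ : Matrix σ σ k) p ∈ Submodule.span k (s : Set (MvPolynomial σ k))) ∧
    f ∈ Ideal.span (s : Set (MvPolynomial σ k))

/-- The **`Γ`-equivariant ideal width of `f` in degree `d`**: the least such `r` (an `sInf` over `ℕ`; junk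
value `0` if no `Γ`-stable finite set of degree-`d` forms generates an ideal containing `f`). -/
def idealWidth (Γ : Subgroup (GL σ k)) (f : MvPolynomial σ k) (d : ℕ) : ℕ :=
  sInf {r | HasIdealWidthLE Γ f d r}

variable {Γ Γ' : Subgroup (GL σ k)} {f : MvPolynomial σ k} {d r r' : ℕ}

/-- Monotone in the bound. -/
theorem HasIdealWidthLE.mono (h : HasIdealWidthLE Γ f d r) (hr : r ≤ r') : HasIdealWidthLE Γ f d r' := by
  obtain ⟨s, hs, h⟩ := h
  exact ⟨s, hs.trans hr, h⟩

/-- Antitone in the group. -/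
theorem HasIdealWidthLE.anti (h : HasIdealWidthLE Γ f d r) (hle : Γ' ≤ Γ) : HasIdealWidthLE Γ' f d r := by
  obtain ⟨s, hs, hh, hΓ, hf⟩ := h
  exact ⟨s, hs, hh, fun γ hγ => hΓ γ (hle hγ), hf⟩

/-- The width is at most any admissible bound. -/
theorem idealWidth_le (h : HasIdealWidthLE Γ f d r) : idealWidth Γ f d ≤ r :=
  Nat.sInf_le h

end Width

/-! ## §2 The equivariant Nisan cut lemma -/

section Cut

variable {σ : Type*} {k : Type*} [CommRing k] {w : ℕ}

/-- Entries of a product of `d` matrices of linear forms are forms of degree `d`. -/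
theorem isHomogeneous_prod_ofFn {d : ℕ} (g : Fin d → Matrix (Fin w) (Fin w) (MvPolynomial σ k))
    (hg : ∀ t i j, (g t i j).IsHomogeneous 1) (i j : Fin w) :
    ((List.ofFn g).prod i j).IsHomogeneous d := by
  induction d generalizing i j with
  | zero =>
    rw [List.ofFn_zero, List.prod_nil, Matrix.one_apply]
    split_ifs
    · exact isHomogeneous_one σ k
    · exact isHomogeneous_zero σ k 0
  | succ d ih =>
    rw [List.ofFn_succ, List.prod_cons, Matrix.mul_apply]
    have h := IsHomogeneous.sum Finset.univ (fun l => g 0 i l * (List.ofFn fun t => g t.succ).prod l j) (1 + d)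
      fun l _ => (hg 0 i l).mul (ih (fun t => g t.succ) (fun t => hg t.succ) l j)
    rwa [add_comm 1 d] at h

/-- `GL_w(k)` acts on matrices of polynomials through the constants. -/
def glC (w : ℕ) : GL (Fin w) k →* GL (Fin w) (MvPolynomial σ k) :=
  Units.map ((C : k →+* MvPolynomial σ k).mapMatrix : Matrix (Fin w) (Fin w) k →+* _).toMonoidHom

/-- `glC` on matrices is `map C`. -/
@[simp] theorem coe_glC (R : GL (Fin w) k) :
    ((glC (σ := σ) w R : GL (Fin w) (MvPolynomial σ k)) : Matrix (Fin w) (Fin w) (MvPolynomial σ k)) =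
      (R : Matrix (Fin w) (Fin w) k).map C := rfl

/-- … and on inverses. -/
@[simp] theorem coe_glC_inv (R : GL (Fin w) k) :
    (((glC (σ := σ) w R)⁻¹ : GL (Fin w) (MvPolynomial σ k)) : Matrix (Fin w) (Fin w) (MvPolynomial σ k)) =
      ((R⁻¹ : GL (Fin w) k) : Matrix (Fin w) (Fin w) k).map C := by
  rw [← map_inv]; rfl

/-- Telescoping: layerwise conjugate transition matrices have a conjugate product. -/
theorem prod_ofFn_telescope {d : ℕ} (g g' : Fin d → Matrix (Fin w) (Fin w) (MvPolynomial σ k))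
    (R : Fin (d + 1) → GL (Fin w) (MvPolynomial σ k))
    (h : ∀ t : Fin d, g' t = ((R t.castSucc : GL (Fin w) (MvPolynomial σ k)) : Matrix (Fin w) (Fin w) (MvPolynomial σ k)) *
      g t * (((R t.succ)⁻¹ : GL (Fin w) (MvPolynomial σ k)) : Matrix (Fin w) (Fin w) (MvPolynomial σ k))) :
    (List.ofFn g').prod = ((R 0 : GL (Fin w) (MvPolynomial σ k)) : Matrix (Fin w) (Fin w) (MvPolynomial σ k)) *
      (List.ofFn g).prod *
        (((R (Fin.last d))⁻¹ : GL (Fin w) (MvPolynomial σ k)) : Matrix (Fin w) (Fin w) (MvPolynomial σ k)) := by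
  induction d with
  | zero =>
    simp only [List.ofFn_zero, List.prod_nil, Matrix.mul_one, Fin.last_zero]
    exact (Units.mul_inv _).symm
  | succ d ih =>
    rw [List.ofFn_succ, List.prod_cons, List.ofFn_succ, List.prod_cons, h 0,
      ih (fun t => g t.succ) (fun t => g' t.succ) (fun t => R t.succ) (fun t => by
        rw [h t.succ, Fin.succ_castSucc])]
    simp only [Fin.castSucc_zero, Fin.succ_zero_eq_one, Fin.succ_last, Matrix.mul_assoc]
    congr 2
    rw [← Matrix.mul_assoc, Units.inv_mul, Matrix.one_mul]

variable {L : ℕ}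

namespace LayeredABP

/-- The HEAD MATRIX of a program of length `d + e` at the cut after `d` edge layers: `T 0 ⋯ T (d-1)`. -/
def headMat {d e : ℕ} (P : LayeredABP σ k (d + e) w) : Matrix (Fin w) (Fin w) (MvPolynomial σ k) :=
  (List.ofFn fun t : Fin d => P.T (Fin.castLE (Nat.le_add_right d e) t)).prod

/-- The HEAD at the cut: the row vector `uᵀ · T 0 ⋯ T (d-1)` of `w` polynomials (Nisan's «left parts»). -/
def head {d e : ℕ} (P : LayeredABP σ k (d + e) w) : Fin w → MvPolynomial σ k :=
  (fun i => C (P.u i)) ᵥ* P.headMat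

/-- The TAIL of the program at the same cut: the column vector `T d ⋯ T (d+e-1) · v`. -/
def tail {d e : ℕ} (P : LayeredABP σ k (d + e) w) : Fin w → MvPolynomial σ k :=
  (List.ofFn fun t : Fin e => P.T (Fin.natAdd d t)).prod *ᵥ fun j => C (P.v j)

/-- **Cut formula** (Nisan): `f = Σ_i head_i · tail_i`. -/
theorem eval_eq_head_dotProduct_tail {d e : ℕ} (P : LayeredABP σ k (d + e) w) :
    P.eval = P.head ⬝ᵥ P.tail := by
  rw [eval, prodT, List.ofFn_add, List.prod_append, ← Matrix.mulVec_mulVec, Matrix.dotProduct_mulVec]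
  rfl

/-- The head polynomials are forms of degree `d`. -/
theorem isHomogeneous_head {d e : ℕ} (P : LayeredABP σ k (d + e) w) (i : Fin w) :
    (P.head i).IsHomogeneous d := by
  simp only [head, headMat, Matrix.vecMul, dotProduct]
  refine IsHomogeneous.sum _ _ _ fun l _ => ?_
  have h := (isHomogeneous_C σ (P.u l)).mul
    (isHomogeneous_prod_ofFn (fun t : Fin d => P.T (Fin.castLE (Nat.le_add_right d e) t)) (fun t => P.linear _) l i)
  rwa [zero_add] at h

variable [Fintype σ] [DecidableEq σ]

/-- The head matrix transforms by conjugation under an exact layerwise lift. -/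
theorem headMat_map {d e : ℕ} (P : LayeredABP σ k (d + e) w) {γ : GL σ k} (Λ : P.Lift γ) :
    P.headMat.map (linSubst σ k (γ : Matrix σ σ k)) =
      ((Λ.R 0 : GL (Fin w) k) : Matrix (Fin w) (Fin w) k).map C * P.headMat *
        (((Λ.R ⟨d, by omega⟩)⁻¹ : GL (Fin w) k) : Matrix (Fin w) (Fin w) k).map C := by
  have h1 : P.headMat.map (linSubst σ k (γ : Matrix σ σ k)) = (List.ofFn fun t : Fin d =>
      Matrix.linSubstEntries γ (P.T (Fin.castLE (Nat.le_add_right d e) t))).prod := by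
    rw [headMat, ← AlgHom.mapMatrix_apply, map_list_prod, List.map_ofFn]
    rfl
  rw [h1, prod_ofFn_telescope (fun t : Fin d => P.T (Fin.castLE (Nat.le_add_right d e) t)) _
      (fun t => glC w (Λ.R (Fin.castLE (by omega) t))) (fun t => ?_)]
  · rw [coe_glC, coe_glC_inv]
    rfl
  · rw [coe_glC, coe_glC_inv]
    exact Λ.layer _

/-- **Head covariance**: under an exact layerwise lift of `γ`, `γ · head_i = Σ_j (a · (R d)⁻¹_{j i}) · head_j`;
in particular the span of the head polynomials is `γ`-stable. -/
theorem linSubst_head {d e : ℕ} (P : LayeredABP σ k (d + e) w) {γ : GL σ k} (Λ : P.Lift γ) (i : Fin w) :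
    linSubst σ k (γ : Matrix σ σ k) (P.head i) =
      ∑ j, ((Λ.a : k) * (((Λ.R ⟨d, by omega⟩)⁻¹ : GL (Fin w) k) : Matrix (Fin w) (Fin w) k) j i) • P.head j := by
  have hvec : ∀ j, linSubst σ k (γ : Matrix σ σ k) (P.head j) =
      ((fun l => C (P.u l)) ᵥ* P.headMat.map (linSubst σ k (γ : Matrix σ σ k))) j := by
    intro j
    have h := RingHom.map_vecMul (linSubst σ k (γ : Matrix σ σ k) : MvPolynomial σ k →+* MvPolynomial σ k)
      P.headMat (fun l => C (P.u l)) j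
    have hcomp : (⇑(linSubst σ k (γ : Matrix σ σ k) : MvPolynomial σ k →+* MvPolynomial σ k) ∘ fun l => C (P.u l))
        = fun l => C (P.u l) := by
      funext l
      simp only [Function.comp_apply, RingHom.coe_coe, linSubst_C]
    rw [hcomp, RingHom.coe_coe] at h
    exact h
  have hsrc : (fun l => C (P.u l)) ᵥ* ((Λ.R 0 : GL (Fin w) k) : Matrix (Fin w) (Fin w) k).map C =
      fun l => (C ((Λ.a : k) * P.u l) : MvPolynomial σ k) := by
    funext l
    have h := (RingHom.map_vecMul (C : k →+* MvPolynomial σ k)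
      ((Λ.R 0 : GL (Fin w) k) : Matrix (Fin w) (Fin w) k) P.u l).symm
    rw [Function.comp_def] at h
    rw [h, Λ.src, Pi.smul_apply, smul_eq_mul]
  rw [hvec i, P.headMat_map Λ, ← Matrix.vecMul_vecMul, ← Matrix.vecMul_vecMul, hsrc]
  simp only [head, Matrix.vecMul, dotProduct, Matrix.map_apply]
  refine Finset.sum_congr rfl fun j _ => ?_
  rw [MvPolynomial.smul_eq_C_mul, Finset.sum_mul, Finset.mul_sum]
  refine Finset.sum_congr rfl fun l _ => ?_
  simp only [map_mul]
  ring

end LayeredABP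

variable [Fintype σ] [DecidableEq σ]

/-- **The equivariant Nisan cut lemma** («ideal width ≤ layer width»).  If `f` is computed by a
`Γ`-equivariant homogeneous layered branching program of width `w`, then at EVERY cut `d` the program's
head polynomials are `≤ w` forms of degree `d` spanning a `Γ`-stable space and generating an ideal that
contains `f`: `HasIdealWidthLE Γ f d w`.  (Nisan 1991 cuts an ABP into left and right parts; the
equivariant content is that exact layerwise lifts act on the left parts through the constant matrix
`(R d)⁻¹`, so their span is a `Γ`-module of dimension `≤ w`.) -/
theorem hasIdealWidthLE_of_layered {Γ : Subgroup (GL σ k)} {d e : ℕ} (P : LayeredABP σ k (d + e) w)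
    (hP : P.IsEquivariant Γ) : HasIdealWidthLE Γ P.eval d w := by
  classical
  refine ⟨Finset.univ.image P.head, Finset.card_image_le.trans (by simp), ?_, ?_, ?_⟩
  · intro p hp
    obtain ⟨i, -, rfl⟩ := Finset.mem_image.mp hp
    exact P.isHomogeneous_head i
  · intro γ hγ p hp
    obtain ⟨i, -, rfl⟩ := Finset.mem_image.mp hp
    obtain ⟨Λ⟩ := hP γ hγ
    rw [P.linSubst_head Λ i]
    refine Submodule.sum_mem _ fun j _ => Submodule.smul_mem _ _ (Submodule.subset_span ?_)
    exact Finset.mem_coe.mpr (Finset.mem_image_of_mem _ (Finset.mem_univ j))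
  · rw [P.eval_eq_head_dotProduct_tail, dotProduct]
    refine Ideal.sum_mem _ fun i _ => Ideal.mul_mem_right _ _ (Ideal.subset_span ?_)
    exact Finset.mem_coe.mpr (Finset.mem_image_of_mem _ (Finset.mem_univ i))

/-- Hence a `Γ`-equivariant layered program of width `w` bounds the equivariant ideal width by `w` at every
cut `d ≤ L`. -/
theorem HasLayeredWidthLE.hasIdealWidthLE {Γ : Subgroup (GL σ k)} {f : MvPolynomial σ k} {L d : ℕ}
    (h : HasLayeredWidthLE Γ f L w) (hd : d ≤ L) : HasIdealWidthLE Γ f d w := by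
  obtain ⟨e, rfl⟩ := Nat.exists_eq_add_of_le hd
  obtain ⟨P, hP, rfl⟩ := h
  exact hasIdealWidthLE_of_layered P hP

/-- `idealWidth ≤ layered width` at every cut `d ≤ L`. -/
theorem idealWidth_le_of_hasLayeredWidthLE {Γ : Subgroup (GL σ k)} {f : MvPolynomial σ k} {L d : ℕ}
    (h : HasLayeredWidthLE Γ f L w) (hd : d ≤ L) : idealWidth Γ f d ≤ w :=
  idealWidth_le (h.hasIdealWidthLE hd)

end Cut

/-! ## §3 The layered notch of the dial and the census cell -/

section Cell

variable (H : ∀ m : ℕ, Subgroup (GL (Fin m × Fin m) ℂ))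

/-- The permanent has a polynomial-width family of `H_m`-equivariant homogeneous layered branching
programs (`m` edge layers for `per_m`, which is a form of degree `m`). -/
def PolyLayered : Prop :=
  ∃ c : ℕ, ∀ m : ℕ, ∃ w : ℕ, w ≤ m ^ c + c ∧ HasLayeredWidthLE (H m) (perPoly (Fin m) ℂ) m w

/-- Piece `A^lay` at the notch `H`: NO polynomial-width `H`-equivariant layered family. -/
def EqHardLayered : Prop := ¬ PolyLayered H

/-- Superpolynomial growth of the `H_m`-equivariant ideal width of `per_m` at some cuts `d ≤ m`
(the typed leaf `R^lay` of the census: an explicit, instrumentable lower-bound target). -/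
def IdealWidthSuperpoly : Prop :=
  ∀ c : ℕ, ∃ m d : ℕ, d ≤ m ∧ m ^ c + c < idealWidth (H m) (perPoly (Fin m) ℂ) d

/-- THE CELL `A^lay`: no polynomial-width family of homogeneous layered branching programs for `per_m` with
exact layerwise lifts of the bi-permutation substitutions `x_{ij} ↦ x_{σ i, τ j}` (window `𝔖_m × 𝔖_m`). -/
def EqHardLayeredBiPerm : Prop := EqHardLayered biPermSubst

variable {H}

/-- Kernel `PolyLayered ⟹ polynomial ideal width at every cut` (the cut lemma, uniformly in `m`). -/
theorem idealWidth_le_of_polyLayered (h : PolyLayered H) :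
    ∃ c : ℕ, ∀ m d : ℕ, d ≤ m → idealWidth (H m) (perPoly (Fin m) ℂ) d ≤ m ^ c + c := by
  obtain ⟨c, hc⟩ := h
  refine ⟨c, fun m d hd => ?_⟩
  obtain ⟨w, hw, hP⟩ := hc m
  exact (idealWidth_le_of_hasLayeredWidthLE hP hd).trans hw

/-- Kernel `R^lay ⟹ A^lay`: superpolynomial equivariant ideal width forces the layered notch. -/
theorem eqHardLayered_of_idealWidthSuperpoly (h : IdealWidthSuperpoly H) : EqHardLayered H := by
  intro hP
  obtain ⟨c, hc⟩ := idealWidth_le_of_polyLayered hP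
  obtain ⟨m, d, hd, hlt⟩ := h c
  exact absurd (hc m d hd) (not_le.mpr hlt)

/-- `EqHardLayered` is monotone in the symmetry family (more symmetry is harder to respect). -/
theorem PolyLayered.anti {H' : ∀ m : ℕ, Subgroup (GL (Fin m × Fin m) ℂ)} (h : PolyLayered H)
    (hle : ∀ m, H' m ≤ H m) : PolyLayered H' := by
  obtain ⟨c, hc⟩ := h
  refine ⟨c, fun m => ?_⟩
  obtain ⟨w, hw, P, hP, hf⟩ := hc m
  exact ⟨w, hw, P, fun γ hγ => hP γ (hle m hγ), hf⟩

/-- `EqHardLayered` is monotone in the symmetry family. -/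
theorem EqHardLayered.mono {H' : ∀ m : ℕ, Subgroup (GL (Fin m × Fin m) ℂ)} (h : EqHardLayered H)
    (hle : ∀ m, H m ≤ H' m) : EqHardLayered H' :=
  fun h' => h (h'.anti hle)

end Cell

end

end Summit.ValiantsHypothesis.ValiantsHypothesis.Theorems.EquivariantDialLayers
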